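/-
Copyright (c) 2026 the pub-hodgecm-mathlib formalisation cell (harness21).  Prover seat hodgecm-mathlib-K2E5-p08 (g0), Track B «K2-LIT» ∕ h413,
unit DET-SECTION of the line `K2_E5_TamagawaUnitary`, file p08: payment of the socket `sig_K2E5DetHermitianDiagonalBasis`
(a non-degenerate hermitian plane over a CM field has a diagonalising basis).  2026-09-03.
-/
import Literature.NumberTheory.Automorphic.AdelicUnitaryGroup   -- ★ `cmConjRingHom` (= Mathlib `IsCMField.complexConj` as a ring hom)
import HarnessLib

/-!
# K2_E5 road (h413 = stmt-HodgeConjecture-24833), unit DET-SECTION, file p08: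
# a non-degenerate hermitian `2 × 2` matrix over a CM field is congruent to `diag(a, b)` with `a, b ∈ L⁺ˣ`

Cell `pub/hodgecm-mathlib` (D-0151), Track B (21-frontier RULING «PUSH BOTH» 2026-09-03, director req624, chair K2-lead,
SKELETON LANDED K2E5 l.72414), socket module
`Summits/HodgeConjecture/HodgeConjecture/Cruxes/H413/Lines/K2_E5_TamagawaUnitary_DetSection.lean` :40 (planner K2E5-plan (g0),
sha16 e27192c58e78046a), socket **`sig_K2E5DetHermitianDiagonalBasis`** (size S, first rung of the unit): for a CM number field `L`
with complex conjugation `σ = cmConjRingHom L` and a matrix `Ha ∈ M₂(L)` with `(σ Ha)ᵀ = Ha` and `det Ha ≠ 0` there are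
`P ∈ GL₂(L)` and `a, b ∈ L` with `σ a = a`, `σ b = b`, `a ≠ 0`, `b ≠ 0` and `(σ P)ᵀ · Ha · P = diag(a, b)`.
The head theorem `detHermitianDiagonalBasis` has the socket's statement TOKEN FOR TOKEN (tie
`example : type_of% @detHermitianDiagonalBasis = type_of% @….K2E5TamagawaUnitary.DetSection.sig_K2E5DetHermitianDiagonalBasis := rfl`
by import at home once the socket module is built on stream 29; never imported here).

THE MATHEMATICS (Gram–Schmidt for a hermitian plane, `char L = 0`; PROOF STRATEGY = «division-free pivot + two elementary
congruences», everything over a general field with an involutive ring endomorphism `σ` and `2 ≠ 0`, then specialised):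
* §1 `exists_diag_of_pivot` — if the pivot `h₀₀ ≠ 0`, the unipotent-times-scalar column operation `P = [[1, −h₀₁], [0, h₀₀]]`
  (det `h₀₀`) gives `(σP)ᵀ Ha P = diag(h₀₀, h₀₀ · det Ha)` — a polynomial identity (`ring`) using only `σ h₀₀ = h₀₀`, `σ h₀₁ = h₁₀`.
* §2 `exists_diag_of_congr`, `congr_hermitian`, `congr_det_ne_zero` — the conclusion transports along any congruence
  `Ha ↦ (σQ)ᵀ Ha Q`, `Q ∈ GL₂` (take `Q · P`), and such a congruence keeps hermitian-ness (`σ ∘ σ = id`) and `det ≠ 0`.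
* §3 `exists_diag` — if `h₀₀ = 0 ≠ h₁₁` swap the basis (`Q = [[0,1],[1,0]]`, new pivot `h₁₁`); if `h₀₀ = h₁₁ = 0` then
  `h₀₁ h₁₀ = −det Ha ≠ 0` and `Q = [[1, 0], [h₁₀, 1]]` produces the pivot `h₀₁ h₁₀ + σ(h₁₀) h₁₀ = 2 h₀₁ h₁₀ ≠ 0`.
* §4 the head: `σ = cmConjRingHom L` is involutive (Mathlib `IsCMField.complexConj_apply_apply`) and `(2 : L) ≠ 0` (`CharZero`).
Mathlib only (`Matrix.GeneralLinearGroup.mkOfDetNeZero`, `Matrix.det_fin_two`, `Matrix.map_mul`, `Matrix.transpose_mul`).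
[cite: Rogawski1990, §1.9 p. 9] [cite: Lam2005, Ch. I Thm. 2.4]

HONEST LABEL: HC_CM is proved only modulo the 7 printed citations (2 remaining named inputs: hLiu418 =
stmt-HodgeConjecture-24832, h413 = stmt-HodgeConjecture-24833) until rung 0 closes; this file is a
`--supports stmt-HodgeConjecture-24833 --as helper` leaf (first rung of unit DET-SECTION of the K2_E5 road) and retires nothing by itself.
-/

set_option autoImplicit false
set_option linter.dupNamespace false   -- `Summit.HodgeConjecture.HodgeConjecture.…` (D-0017 nested layout; lakefile exemption for Summits)

noncomputable section

namespace Summit.HodgeConjecture.HodgeConjecture.Cruxes.H413.K2E5DetHermitianDiagonalBasis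

open NumberField
open Literature.NumberTheory.Automorphic
open scoped Matrix MatrixGroups

section Generic

variable {L : Type*} [Field L] (σ : L →+* L)

/-! ## §1  The pivot step (division-free) -/

/-- Entries of a `σ`-hermitian matrix: `σ (Ha j i) = Ha i j`. [folklore] -/
theorem apply_eq_of_hermitian {Ha : Matrix (Fin 2) (Fin 2) L} (hH : (Ha.map σ)ᵀ = Ha) (i j : Fin 2) :
    σ (Ha j i) = Ha i j := by
  have h := congrFun (congrFun hH i) j
  simpa only [Matrix.transpose_apply, Matrix.map_apply] using h

/-- **Pivot step.**  If `Ha` is `σ`-hermitian with `det Ha ≠ 0` and `Ha 0 0 ≠ 0`, then with the column operation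
`P = [[1, −h₀₁], [0, h₀₀]]` one has `(σP)ᵀ Ha P = diag(h₀₀, h₀₀ · det Ha)`; both diagonal entries are `σ`-fixed and nonzero.
[cite: Lam2005, Ch. I Thm. 2.4] -/
theorem exists_diag_of_pivot (Ha : Matrix (Fin 2) (Fin 2) L) (hH : (Ha.map σ)ᵀ = Ha) (hdet : Ha.det ≠ 0)
    (h00 : Ha 0 0 ≠ 0) :
    ∃ (P : GL (Fin 2) L) (a b : L), σ a = a ∧ σ b = b ∧ a ≠ 0 ∧ b ≠ 0 ∧
      ((P : Matrix (Fin 2) (Fin 2) L).map σ)ᵀ * Ha * (P : Matrix (Fin 2) (Fin 2) L) = Matrix.diagonal ![a, b] := by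
  have h00r : σ (Ha 0 0) = Ha 0 0 := apply_eq_of_hermitian σ hH 0 0
  have h11r : σ (Ha 1 1) = Ha 1 1 := apply_eq_of_hermitian σ hH 1 1
  have h01r : σ (Ha 1 0) = Ha 0 1 := apply_eq_of_hermitian σ hH 0 1
  have h10r : σ (Ha 0 1) = Ha 1 0 := apply_eq_of_hermitian σ hH 1 0
  have hPdet : (!![1, -Ha 0 1; 0, Ha 0 0] : Matrix (Fin 2) (Fin 2) L).det ≠ 0 := by
    rw [Matrix.det_fin_two_of]; simpa using h00
  refine ⟨Matrix.GeneralLinearGroup.mkOfDetNeZero _ hPdet, Ha 0 0, Ha 0 0 * Ha.det, h00r, ?_, h00,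
    mul_ne_zero h00 hdet, ?_⟩
  · rw [map_mul, h00r, Matrix.det_fin_two, map_sub, map_mul, map_mul, h00r, h11r, h01r, h10r, mul_comm (Ha 1 0)]
  · rw [Matrix.GeneralLinearGroup.val_mkOfDetNeZero]
    ext i j
    fin_cases i <;> fin_cases j <;>
      simp [Matrix.mul_apply, Fin.sum_univ_two, Matrix.diagonal, Matrix.det_fin_two, h00r, h10r] <;> ring

/-! ## §2  Transport along a congruence -/

/-- A congruence `Ha ↦ (σQ)ᵀ Ha Q` by an invertible `Q` transports diagonalisability back to `Ha` (use `Q · P`). [folklore] -/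
theorem exists_diag_of_congr (Ha : Matrix (Fin 2) (Fin 2) L) (Q : GL (Fin 2) L)
    (h : ∃ (P : GL (Fin 2) L) (a b : L), σ a = a ∧ σ b = b ∧ a ≠ 0 ∧ b ≠ 0 ∧
      ((P : Matrix (Fin 2) (Fin 2) L).map σ)ᵀ * ((((Q : Matrix (Fin 2) (Fin 2) L).map σ)ᵀ * Ha * (Q : Matrix (Fin 2) (Fin 2) L))) *
        (P : Matrix (Fin 2) (Fin 2) L) = Matrix.diagonal ![a, b]) :
    ∃ (P : GL (Fin 2) L) (a b : L), σ a = a ∧ σ b = b ∧ a ≠ 0 ∧ b ≠ 0 ∧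
      ((P : Matrix (Fin 2) (Fin 2) L).map σ)ᵀ * Ha * (P : Matrix (Fin 2) (Fin 2) L) = Matrix.diagonal ![a, b] := by
  obtain ⟨P, a, b, ha, hb, ha0, hb0, hP⟩ := h
  refine ⟨Q * P, a, b, ha, hb, ha0, hb0, ?_⟩
  rw [← hP, Matrix.GeneralLinearGroup.coe_mul, Matrix.map_mul, Matrix.transpose_mul]
  simp only [Matrix.mul_assoc]

/-- A congruence by any `Q` keeps `σ`-hermitian-ness when `σ` is an involution. [folklore] -/
theorem congr_hermitian (hσ : ∀ x, σ (σ x) = x) (Ha Q : Matrix (Fin 2) (Fin 2) L) (hH : (Ha.map σ)ᵀ = Ha) :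
    (((Q.map σ)ᵀ * Ha * Q).map σ)ᵀ = (Q.map σ)ᵀ * Ha * Q := by
  have hQ : (Q.map σ).map σ = Q := by
    ext i j; simp only [Matrix.map_apply, hσ]
  rw [Matrix.map_mul, Matrix.map_mul, Matrix.transpose_map, hQ, Matrix.transpose_mul, Matrix.transpose_mul,
    Matrix.transpose_transpose, hH, Matrix.mul_assoc]

/-- A congruence by an invertible `Q` keeps `det ≠ 0` (`det ((σQ)ᵀ Ha Q) = σ(det Q) · det Ha · det Q`). [folklore] -/
theorem congr_det_ne_zero (Ha : Matrix (Fin 2) (Fin 2) L) (Q : GL (Fin 2) L) (hdet : Ha.det ≠ 0) :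
    ((((Q : Matrix (Fin 2) (Fin 2) L).map σ)ᵀ * Ha * (Q : Matrix (Fin 2) (Fin 2) L))).det ≠ 0 := by
  have hQ : (Q : Matrix (Fin 2) (Fin 2) L).det ≠ 0 :=
    ((Matrix.isUnit_iff_isUnit_det _).mp Q.isUnit).ne_zero
  rw [Matrix.det_mul, Matrix.det_mul, Matrix.det_transpose, ← RingHom.mapMatrix_apply, ← RingHom.map_det]
  exact mul_ne_zero (mul_ne_zero ((map_ne_zero σ).mpr hQ) hdet) hQ

/-! ## §3  The generic diagonalisation -/

/-- **Generic hermitian Gram–Schmidt for planes.**  Over a field with `2 ≠ 0` and an involutive ring endomorphism `σ`,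
every `σ`-hermitian `Ha ∈ M₂` with `det Ha ≠ 0` is congruent to `diag(a, b)` with `σ`-fixed nonzero `a, b`:
pivot on `h₀₀` if nonzero; else swap if `h₁₁ ≠ 0`; else (`h₀₀ = h₁₁ = 0`, `h₀₁ h₁₀ = −det ≠ 0`) the congruence by
`[[1, 0], [h₁₀, 1]]` creates the pivot `2 h₀₁ h₁₀ ≠ 0`.
[cite: Lam2005, Ch. I Thm. 2.4] [cite: Rogawski1990, §1.9 p. 9] -/
theorem exists_diag (hσ : ∀ x, σ (σ x) = x) (h2 : (2 : L) ≠ 0)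
    (Ha : Matrix (Fin 2) (Fin 2) L) (hH : (Ha.map σ)ᵀ = Ha) (hdet : Ha.det ≠ 0) :
    ∃ (P : GL (Fin 2) L) (a b : L), σ a = a ∧ σ b = b ∧ a ≠ 0 ∧ b ≠ 0 ∧
      ((P : Matrix (Fin 2) (Fin 2) L).map σ)ᵀ * Ha * (P : Matrix (Fin 2) (Fin 2) L) = Matrix.diagonal ![a, b] := by
  by_cases h00 : Ha 0 0 ≠ 0
  · exact exists_diag_of_pivot σ Ha hH hdet h00
  rw [not_ne_iff] at h00
  have h01r : σ (Ha 1 0) = Ha 0 1 := apply_eq_of_hermitian σ hH 0 1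
  by_cases h11 : Ha 1 1 ≠ 0
  · -- swap the two basis vectors: the new pivot is `h₁₁`
    have hQdet : (!![0, 1; 1, 0] : Matrix (Fin 2) (Fin 2) L).det ≠ 0 := by
      rw [Matrix.det_fin_two_of]; simp
    refine exists_diag_of_congr σ Ha (Matrix.GeneralLinearGroup.mkOfDetNeZero _ hQdet)
      (exists_diag_of_pivot σ _ (congr_hermitian σ hσ Ha _ hH) (congr_det_ne_zero σ Ha _ hdet) ?_)
    rw [Matrix.GeneralLinearGroup.val_mkOfDetNeZero]
    simpa [Matrix.mul_apply, Fin.sum_univ_two] using h11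
  · -- `h₀₀ = h₁₁ = 0`: create a pivot
    rw [not_ne_iff] at h11
    have h0110 : Ha 0 1 * Ha 1 0 ≠ 0 := by
      intro h
      apply hdet
      rw [Matrix.det_fin_two, h00, h11, h, zero_mul, sub_zero]
    have hQdet : (!![1, 0; Ha 1 0, 1] : Matrix (Fin 2) (Fin 2) L).det ≠ 0 := by
      rw [Matrix.det_fin_two_of]; simp
    refine exists_diag_of_congr σ Ha (Matrix.GeneralLinearGroup.mkOfDetNeZero _ hQdet)
      (exists_diag_of_pivot σ _ (congr_hermitian σ hσ Ha _ hH) (congr_det_ne_zero σ Ha _ hdet) ?_)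
    rw [Matrix.GeneralLinearGroup.val_mkOfDetNeZero]
    have hpiv : (((!![1, 0; Ha 1 0, 1] : Matrix (Fin 2) (Fin 2) L).map σ)ᵀ * Ha * !![1, 0; Ha 1 0, 1]) 0 0 =
        2 * (Ha 0 1 * Ha 1 0) := by
      simp [Matrix.mul_apply, Fin.sum_univ_two, h00, h11, h01r]; ring
    rw [hpiv]
    exact mul_ne_zero h2 h0110

end Generic

/-! ## §4  The head -/

/-- **PAYMENT OF `sig_K2E5DetHermitianDiagonalBasis`** (socket :40 of unit DET-SECTION of the K2_E5 road,
`Cruxes/H413/Lines/K2_E5_TamagawaUnitary_DetSection.lean`, TOKEN FOR TOKEN): a non-degenerate hermitian `2 × 2` matrix `Ha`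
over a CM field `L` (`(σ Ha)ᵀ = Ha`, `det Ha ≠ 0`, `σ = cmConjRingHom L`) is congruent, `(σP)ᵀ Ha P` with `P ∈ GL₂(L)`, to a
diagonal matrix `diag(a, b)` with `a, b` `σ`-fixed (i.e. in `L⁺`) and nonzero — Gram–Schmidt for hermitian forms in
characteristic `0`; §3 with `σ` involutive (Mathlib `IsCMField.complexConj_apply_apply`) and `(2 : L) ≠ 0`.
[cite: Rogawski1990, §1.9 p. 9] [cite: Lam2005, Ch. I Thm. 2.4] -/
theorem detHermitianDiagonalBasis :
    ∀ (L : Type) [Field L] [NumberField L] [IsCMField L]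
      (Ha : Matrix (Fin 2) (Fin 2) L) (_ : (Ha.map (cmConjRingHom L)).transpose = Ha) (_ : Ha.det ≠ 0),
      ∃ (P : GL (Fin 2) L) (a b : L), cmConjRingHom L a = a ∧ cmConjRingHom L b = b ∧ a ≠ 0 ∧ b ≠ 0 ∧
        ((P : Matrix (Fin 2) (Fin 2) L).map (cmConjRingHom L))ᵀ * Ha * (P : Matrix (Fin 2) (Fin 2) L) = Matrix.diagonal ![a, b] := by
  intro L _ _ _ Ha hH hdet
  exact exists_diag (cmConjRingHom L) (fun x => IsCMField.complexConj_apply_apply L x) two_ne_zero Ha hH hdet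

end Summit.HodgeConjecture.HodgeConjecture.Cruxes.H413.K2E5DetHermitianDiagonalBasis

end
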